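import Summits.CriticalPhenomena.PercolationContinuityZ3.Theorems.PercNearOneGluingNoHeavyLowerTailSahiOneStepRelativeLYMFibre
import Summits.CriticalPhenomena.PercolationContinuityZ3.Theorems.PercNearOneGluingNoHeavyLowerTailSahiOneStepFibre
import Summits.CriticalPhenomena.PercolationContinuityZ3.Theorems.PercNearOneGluingNoHeavyLowerTailSahiOneStepLayerMonotone
import Literature.Probability.Percolation.SiteMonotonicity
import HarnessLib

/-!
# One-step scheme: the RELATIVE LYM inequality (THEOREM A of the vertex-cover memo), measure form

Support file (prover prim-ineq-prove-3 gen 37; `--supports stmt-CriticalPhenomena-4575`; memo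
`run/shared/lean/prim/prim-ineq-prove-3/PROOF-G37-VERTEX-COVER-PARTNERS.md` §3–4).  No definitions, no named facts, no sorries.

THEOREM A (`relLYM_real_mul_le`): for a product measure `μ`, an increasing `F`-determined event `U`, `N ⊆ F`, `V := U ∩ {some coordinate of N absent}`,
`D := Uᶜ` and the levels `N_k = {N_F = k}`:  `μ(V ∩ N_{m′})·μ(D ∩ N_m) ≤ μ(V ∩ N_m)·μ(D ∩ N_{m′})` for `m′ < m` — the level law of `D` lies below the
level law of `V` in the likelihood-ratio order.  This is the inequality behind `Ψ ≥ 0` at every non-isolated vertex of a vertex-cover (2-CNF) partner.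
Proof: expand both products as sums over pairs of `F`-patterns (`…SahiOneStepFibre`), group by the fibre `(S ∩ S′, S ∪ S′)` on which the pair weight is
constant, and compare the two counts on each fibre (`fibre_card_filter_le`) — which is the per-fibre counting lemma `card_filter_le_card_filter_of_downClosed`
of `…RelativeLYMFibre` (Katona + degree counting) transported along `(S,S′) ↦ S′ ∖ I` and `P ↦ (I ∪ ((J∖I)∖P), I ∪ P)`.
-/

namespace Summit.CriticalPhenomena.PercolationContinuityZ3.Theorems

namespace SahiOneStep

open Finset
open scoped FinsetFamily

variable {ι : Type*} [DecidableEq ι]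

/-! ## The fibre inequality for an increasing event (x-coordinates) -/
open scoped Classical

/-- Structure of a two-copy fibre: if `S ∩ S′ = I` and `S ∪ S′ = J` then `S = I ∪ ((J ∖ I) ∖ (S′ ∖ I))` and `S′ = I ∪ (S′ ∖ I)`. [folklore] -/
theorem fibre_fst_eq {I J S S' : Finset ι} (h1 : S ∩ S' = I) (h2 : S ∪ S' = J) :
    S = I ∪ ((J \ I) \ (S' \ I)) ∧ S' = I ∪ (S' \ I) := by
  have key : ∀ i, (i ∈ I ↔ i ∈ S ∧ i ∈ S') := fun i => by rw [← h1, mem_inter]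
  have key2 : ∀ i, (i ∈ J ↔ i ∈ S ∨ i ∈ S') := fun i => by rw [← h2, mem_union]
  constructor
  · ext i; simp only [mem_union, mem_sdiff, key, key2]; tauto
  · ext i; simp only [mem_union, mem_sdiff, key]; tauto

-- lane heartbeat margin (passes at 180k, fails at 160k; lake-build factor ≈1.1): budget line, proof unchanged
set_option maxHeartbeats 400000 in
/-- **FIBRE INEQUALITY (x-coordinates).**  `U` increasing; on the fibre `{(S,S′) : S ∩ S′ = I, S ∪ S′ = J}` of pairs of `F`-patterns, for levels
`m′ < m`, the pairs with `S ∈ U` missing an element of `N` at level `m′` and `S′ ∉ U` at level `m` are at most as many as those with the levels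
exchanged.  (Per-fibre lemma (PF) `card_filter_le_card_filter_of_downClosed` applied to `𝒟 = {Q ⊆ J∖I : I ∪ ((J∖I)∖Q) ∈ U}` through the maps
`(S,S′) ↦ S′ ∖ I` and `P ↦ (I ∪ ((J∖I)∖P), I ∪ P)`.) [this work] -/
theorem fibre_card_filter_le (F N I J : Finset ι) {U : Set (Set ι)} (hU : IsUpperSet U) {m' m : ℕ} (hm : m' < m) :
    #(((F.powerset ×ˢ F.powerset).filter fun x => (x.1 ∩ x.2, x.1 ∪ x.2) = (I, J)).filter fun x =>
        ((↑x.1 : Set ι) ∈ U ∧ (∃ f ∈ N, f ∉ x.1) ∧ #x.1 = m') ∧ ((↑x.2 : Set ι) ∉ U ∧ #x.2 = m)) ≤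
    #(((F.powerset ×ˢ F.powerset).filter fun x => (x.1 ∩ x.2, x.1 ∪ x.2) = (I, J)).filter fun x =>
        ((↑x.1 : Set ι) ∈ U ∧ (∃ f ∈ N, f ∉ x.1) ∧ #x.1 = m) ∧ ((↑x.2 : Set ι) ∉ U ∧ #x.2 = m')) := by
  set fib := (F.powerset ×ˢ F.powerset).filter fun x => (x.1 ∩ x.2, x.1 ∪ x.2) = (I, J) with hfib
  set fm := fib.filter fun x => ((↑x.1 : Set ι) ∈ U ∧ (∃ f ∈ N, f ∉ x.1) ∧ #x.1 = m') ∧ ((↑x.2 : Set ι) ∉ U ∧ #x.2 = m) with hfm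
  set fp := fib.filter fun x => ((↑x.1 : Set ι) ∈ U ∧ (∃ f ∈ N, f ∉ x.1) ∧ #x.1 = m) ∧ ((↑x.2 : Set ι) ∉ U ∧ #x.2 = m') with hfp
  rcases fm.eq_empty_or_nonempty with hfe | ⟨x₀, hx₀⟩
  · rw [hfe, card_empty]; exact Nat.zero_le _
  -- structural facts, read off from a member of the (nonempty) family
  have hmemfib : ∀ x ∈ fib, (x.1 ⊆ F ∧ x.2 ⊆ F) ∧ x.1 ∩ x.2 = I ∧ x.1 ∪ x.2 = J := by
    intro x hx
    rw [hfib, mem_filter, mem_product, mem_powerset, mem_powerset] at hx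
    simp only [Prod.mk.injEq] at hx
    exact ⟨hx.1, hx.2.1, hx.2.2⟩
  rw [hfm, mem_filter] at hx₀
  obtain ⟨hx₀F, h1₀, h2₀⟩ := hmemfib x₀ hx₀.1
  obtain ⟨⟨-, -, hc1⟩, -, hc2⟩ := hx₀.2
  have hIJ : I ⊆ J := by rw [← h1₀, ← h2₀]; exact inter_subset_left.trans subset_union_left
  have hJF : J ⊆ F := by rw [← h2₀]; exact union_subset hx₀F.1 hx₀F.2
  set R := J \ I with hR
  have hRI : Disjoint R I := disjoint_sdiff_self_left
  have hIR : I ∪ R = J := union_sdiff_of_subset hIJ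
  have hsum : m' + m = #I + #J := by rw [← hc1, ← hc2, ← h1₀, ← h2₀, add_comm (#(x₀.1 ∩ x₀.2)), card_union_add_card_inter]
  have hIm' : #I ≤ m' := by rw [← hc1, ← h1₀]; exact card_le_card inter_subset_left
  have hRcard : #R = #J - #I := card_sdiff_of_subset hIJ
  have hJI : #I ≤ #J := card_le_card hIJ
  set a := m' - #I with ha
  set b := m - #I with hb
  have hab : a < b := by omega
  have hRab : #R = a + b := by omega
  -- the down-closed family on `R`
  set 𝒟 := R.powerset.filter fun Q => (↑(I ∪ (R \ Q)) : Set ι) ∈ U with h𝒟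
  have hmem𝒟 : ∀ Q, Q ⊆ R → (Q ∈ 𝒟 ↔ (↑(I ∪ (R \ Q)) : Set ι) ∈ U) := fun Q hQ => by
    rw [h𝒟, mem_filter, mem_powerset]; exact ⟨fun h => h.2, fun h => ⟨hQ, h⟩⟩
  have hdown : ∀ P ∈ 𝒟, ∀ Q, Q ⊆ P → Q ∈ 𝒟 := by
    intro P hP Q hQP
    rw [h𝒟, mem_filter, mem_powerset] at hP ⊢
    refine ⟨hQP.trans hP.1, hU ?_ hP.2⟩
    exact coe_subset.2 (union_subset_union subset_rfl (sdiff_subset_sdiff subset_rfl hQP))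
  set N' := if N ⊆ J then N ∩ R else R with hN'
  have hN'R : N' ⊆ R := by rw [hN']; split_ifs; exacts [inter_subset_right, subset_rfl]
  set 𝒬 := (R.powersetCard b).filter fun Q => Q ∈ 𝒟 ∧ R \ Q ∉ 𝒟 ∧ (Q ∩ N').Nonempty with h𝒬
  set 𝒫₁ := (R.powersetCard a).filter fun P => P ∈ 𝒟 ∧ R \ P ∉ 𝒟 ∧ (P ∩ N').Nonempty with h𝒫₁
  have hPF := card_filter_le_card_filter_of_downClosed R N' 𝒟 hdown a b hab hRab hN'R
  -- injection 1: `x ↦ x.2 ∖ I`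
  have h1 : #fm ≤ #𝒬 := by
    refine card_le_card_of_injOn (fun x => x.2 \ I) (fun x hx => ?_) (fun x hx x' hx' hxx' => ?_)
    · rw [mem_coe, hfm, mem_filter] at hx
      obtain ⟨hxfib, ⟨hU1, hN1, hc1'⟩, hU2, hc2'⟩ := hx
      obtain ⟨-, h1, h2⟩ := hmemfib x hxfib
      obtain ⟨e1, e2⟩ := fibre_fst_eq h1 h2
      have hQR : x.2 \ I ⊆ R := by rw [hR, ← h2]; exact sdiff_subset_sdiff subset_union_right subset_rfl
      have hIx2 : I ⊆ x.2 := by rw [← h1]; exact inter_subset_right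
      rw [mem_coe, h𝒬, mem_filter, mem_powersetCard]
      refine ⟨⟨hQR, by rw [card_sdiff_of_subset hIx2, hc2']⟩, ?_, ?_, ?_⟩
      · have e1' : I ∪ (R \ (x.2 \ I)) = x.1 := by rw [hR]; exact e1.symm
        rw [hmem𝒟 _ hQR, e1']; exact hU1
      · rw [hmem𝒟 _ sdiff_subset, Finset.sdiff_sdiff_eq_self hQR, ← e2]; exact hU2
      · rw [hN']
        split_ifs with hNJ
        · obtain ⟨f, hfN, hfx⟩ := hN1
          have hfJ : f ∈ J := hNJ hfN
          rw [← h2, mem_union] at hfJ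
          have hf2 : f ∈ x.2 := hfJ.resolve_left hfx
          have hfI : f ∉ I := fun h => hfx (by rw [← h1] at h; exact (mem_inter.1 h).1)
          exact ⟨f, mem_inter.2 ⟨mem_sdiff.2 ⟨hf2, hfI⟩, mem_inter.2 ⟨hfN, by rw [hR, mem_sdiff, ← h2]; exact ⟨mem_union_right _ hf2, hfI⟩⟩⟩⟩
        · rw [inter_eq_left.2 hQR, ← card_pos, card_sdiff_of_subset hIx2, hc2']; omega
    · rw [mem_coe, hfm, mem_filter] at hx hx'
      obtain ⟨-, h1, h2⟩ := hmemfib x hx.1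
      obtain ⟨-, h1', h2'⟩ := hmemfib x' hx'.1
      obtain ⟨e1, e2⟩ := fibre_fst_eq h1 h2
      obtain ⟨e1', e2'⟩ := fibre_fst_eq h1' h2'
      have hxx : x.2 \ I = x'.2 \ I := hxx'
      exact Prod.ext (by rw [e1, e1', hxx]) (by rw [e2, e2', hxx])
  -- injection 2: `P ↦ (I ∪ (R ∖ P), I ∪ P)`
  have h2 : #𝒫₁ ≤ #fp := by
    refine card_le_card_of_injOn (fun P => (I ∪ (R \ P), I ∪ P)) (fun P hP => ?_) (fun P hP P' hP' hPP' => ?_)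
    · rw [mem_coe, h𝒫₁, mem_filter, mem_powersetCard] at hP
      obtain ⟨⟨hPR, hPa⟩, hP𝒟, hRP𝒟, hPN⟩ := hP
      have hPI : Disjoint P I := disjoint_of_subset_left hPR hRI
      have hRPI : Disjoint (R \ P) I := disjoint_of_subset_left sdiff_subset hRI
      rw [mem_coe, hfp, mem_filter, hfib, mem_filter, mem_product, mem_powerset, mem_powerset]
      refine ⟨⟨⟨?_, ?_⟩, ?_⟩, ⟨(hmem𝒟 P hPR).1 hP𝒟, ?_, ?_⟩, ?_, ?_⟩
      · exact union_subset (hIJ.trans hJF) ((sdiff_subset.trans sdiff_subset).trans hJF)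
      · exact union_subset (hIJ.trans hJF) ((hPR.trans sdiff_subset).trans hJF)
      · simp only [Prod.mk.injEq]
        constructor
        · ext i
          simp only [mem_inter, mem_union, mem_sdiff]
          constructor
          · rintro ⟨h₁ | ⟨-, hnP⟩, h₂ | hP⟩ <;> first | exact h₁ | exact h₂ | exact absurd hP hnP
          · intro hi; exact ⟨Or.inl hi, Or.inl hi⟩
        · ext i
          have hPRi : i ∈ P → i ∈ R := fun h => hPR h
          rw [← hIR]
          simp only [mem_union, mem_sdiff]
          tauto
      · rw [hN'] at hPN
        split_ifs at hPN with hNJ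
        · obtain ⟨f, hf⟩ := hPN
          rw [mem_inter, mem_inter] at hf
          refine ⟨f, hf.2.1, fun h => ?_⟩
          rcases mem_union.1 h with h | h
          · exact (mem_sdiff.1 hf.2.2).2 h
          · exact (mem_sdiff.1 h).2 hf.1
        · obtain ⟨f, hfN, hfJ⟩ := not_subset.1 hNJ
          exact ⟨f, hfN, fun h => hfJ ((union_subset hIJ (sdiff_subset.trans sdiff_subset)) h)⟩
      · rw [card_union_of_disjoint hRPI.symm, card_sdiff_of_subset hPR, hRab, hPa]; omega
      · rw [hmem𝒟 _ sdiff_subset, Finset.sdiff_sdiff_eq_self hPR] at hRP𝒟; exact hRP𝒟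
      · rw [card_union_of_disjoint hPI.symm, hPa]; omega
    · have e : I ∪ P = I ∪ P' := congrArg Prod.snd hPP'
      rw [mem_coe, h𝒫₁, mem_filter, mem_powersetCard] at hP hP'
      have hPI : Disjoint P I := disjoint_of_subset_left hP.1.1 hRI
      have hPI' : Disjoint P' I := disjoint_of_subset_left hP'.1.1 hRI
      calc P = (I ∪ P) \ I := by rw [union_sdiff_left, hPI.sdiff_eq_left]
        _ = (I ∪ P') \ I := by rw [e]
        _ = P' := by rw [union_sdiff_left, hPI'.sdiff_eq_left]
  exact h1.trans (hPF.trans h2)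

/-! ## THEOREM A at the measure level -/
section Measure

open MeasureTheory
open Literature.Probability.Percolation (DeterminedBy determinedBy_iff)
open Literature.Probability.LatticeModels (prodBernoulli)
open Literature.Probability.Percolation.DecisionTree (ind wtW)

omit [DecidableEq ι] in
/-- The event "some coordinate of `N` is absent" is determined by any block containing `N`. [folklore] -/
theorem determinedBy_missing (N F : Finset ι) (hNF : N ⊆ F) :
    DeterminedBy {ω : Set ι | ∃ f ∈ N, f ∉ ω} (↑F : Set ι) := by
  rw [determinedBy_iff]
  intro ω ω' h
  have key : ∀ f ∈ N, (f ∈ ω ↔ f ∈ ω') := fun f hf => by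
    have hfF : f ∈ (↑F : Set ι) := Finset.mem_coe.2 (hNF hf)
    constructor
    · intro hfω; exact ((Set.ext_iff.1 h f).1 ⟨hfω, hfF⟩).1
    · intro hfω; exact ((Set.ext_iff.1 h f).2 ⟨hfω, hfF⟩).1
  simp only [Set.mem_setOf_eq]
  exact exists_congr fun f => and_congr_right fun hf => not_congr (key f hf)

/-- A product of two measures of `F`-determined events as a sum over pairs of `F`-patterns. [this work] -/
theorem real_mul_real_eq_sum_pairs (p : ι → unitInterval) {F : Finset ι} {X Y : Set (Set ι)} (hX : DeterminedBy X (↑F : Set ι))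
    (hY : DeterminedBy Y (↑F : Set ι)) :
    (prodBernoulli p).real X * (prodBernoulli p).real Y =
      ∑ x ∈ F.powerset ×ˢ F.powerset, wtW F (fun i => (p i : ℝ)) x.1 * wtW F (fun i => (p i : ℝ)) x.2 * (ind (pat X) x.1 * ind (pat Y) x.2) := by
  rw [real_eq_sum_wtW_ind p hX, real_eq_sum_wtW_ind p hY, Finset.sum_mul_sum, ← Finset.sum_product']
  exact Finset.sum_congr rfl fun x _ => by ring

/-- **THEOREM A (relative LYM inequality), measure form.**  `U` increasing and determined by `F`, `N ⊆ F`; `V = U ∩ {some coordinate of N absent}`,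
`D = Uᶜ`, levels `N_k = {N_F = k}`.  Then for `m′ < m`:  `μ(V ∩ N_{m′})·μ(D ∩ N_m) ≤ μ(V ∩ N_m)·μ(D ∩ N_{m′})` — the level distribution of `D` is
below that of `V` in the likelihood-ratio order (memo THEOREM A in x-coordinates; fibrewise by `fibre_card_filter_le`). [this work] -/
theorem relLYM_real_mul_le (p : ι → unitInterval) (F N : Finset ι) (hNF : N ⊆ F) {U : Set (Set ι)} (hU : IsUpperSet U)
    (hUF : DeterminedBy U (↑F : Set ι)) {m' m : ℕ} (hm : m' < m) :
    (prodBernoulli p).real (U ∩ {ω : Set ι | ∃ f ∈ N, f ∉ ω} ∩ {ω : Set ι | (F.filter (· ∈ ω)).card = m'}) *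
        (prodBernoulli p).real (Uᶜ ∩ {ω : Set ι | (F.filter (· ∈ ω)).card = m}) ≤
      (prodBernoulli p).real (U ∩ {ω : Set ι | ∃ f ∈ N, f ∉ ω} ∩ {ω : Set ι | (F.filter (· ∈ ω)).card = m}) *
        (prodBernoulli p).real (Uᶜ ∩ {ω : Set ι | (F.filter (· ∈ ω)).card = m'}) := by
  set μ := prodBernoulli p with hμ
  set pr : ι → ℝ := fun i => (p i : ℝ) with hpr
  have hp0 : ∀ i, 0 ≤ pr i := fun i => (p i).2.1
  have hp1 : ∀ i, pr i ≤ 1 := fun i => (p i).2.2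
  set Ms : Set (Set ι) := {ω : Set ι | ∃ f ∈ N, f ∉ ω} with hMs
  set Lv : ℕ → Set (Set ι) := fun k => {ω : Set ι | (F.filter (· ∈ ω)).card = k} with hLv
  have hMsF : DeterminedBy Ms (↑F : Set ι) := determinedBy_missing N F hNF
  have hV : ∀ k, DeterminedBy (U ∩ Ms ∩ Lv k) (↑F : Set ι) := fun k => (hUF.inter hMsF).inter (determinedBy_layer F k)
  have hD : ∀ k, DeterminedBy (Uᶜ ∩ Lv k) (↑F : Set ι) := fun k => hUF.compl.inter (determinedBy_layer F k)
  change μ.real (U ∩ Ms ∩ Lv m') * μ.real (Uᶜ ∩ Lv m) ≤ μ.real (U ∩ Ms ∩ Lv m) * μ.real (Uᶜ ∩ Lv m')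
  rw [real_mul_real_eq_sum_pairs p (hV m') (hD m), real_mul_real_eq_sum_pairs p (hV m) (hD m'), ← sub_nonneg, ← Finset.sum_sub_distrib]
  -- the kernel of the difference
  have hker : ∀ x ∈ F.powerset ×ˢ F.powerset,
      wtW F pr x.1 * wtW F pr x.2 * (ind (pat (U ∩ Ms ∩ Lv m)) x.1 * ind (pat (Uᶜ ∩ Lv m')) x.2) -
        wtW F pr x.1 * wtW F pr x.2 * (ind (pat (U ∩ Ms ∩ Lv m')) x.1 * ind (pat (Uᶜ ∩ Lv m)) x.2) =
      wtW F pr x.1 * wtW F pr x.2 *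
        (ind (pat (U ∩ Ms ∩ Lv m)) x.1 * ind (pat (Uᶜ ∩ Lv m')) x.2 - ind (pat (U ∩ Ms ∩ Lv m')) x.1 * ind (pat (Uᶜ ∩ Lv m)) x.2) :=
    fun x _ => by ring
  rw [Finset.sum_congr rfl hker]
  -- group by fibres
  rw [← Finset.sum_fiberwise_of_maps_to (g := fun x : Finset ι × Finset ι => (x.1 ∩ x.2, x.1 ∪ x.2))
    (t := F.powerset ×ˢ F.powerset) (fun x hx => by
      simp only [Finset.mem_product, Finset.mem_powerset] at hx ⊢
      exact ⟨Finset.inter_subset_left.trans hx.1, Finset.union_subset hx.1 hx.2⟩)]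
  refine Finset.sum_nonneg fun IJ _ => ?_
  set fib := (F.powerset ×ˢ F.powerset).filter (fun x => (x.1 ∩ x.2, x.1 ∪ x.2) = IJ) with hfib
  have hc : ∀ x ∈ fib,
      wtW F pr x.1 * wtW F pr x.2 *
        (ind (pat (U ∩ Ms ∩ Lv m)) x.1 * ind (pat (Uᶜ ∩ Lv m')) x.2 - ind (pat (U ∩ Ms ∩ Lv m')) x.1 * ind (pat (Uᶜ ∩ Lv m)) x.2) =
      wfib F pr IJ.1 IJ.2 *
        (ind (pat (U ∩ Ms ∩ Lv m)) x.1 * ind (pat (Uᶜ ∩ Lv m')) x.2 - ind (pat (U ∩ Ms ∩ Lv m')) x.1 * ind (pat (Uᶜ ∩ Lv m)) x.2) := by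
    intro x hx
    rw [hfib, Finset.mem_filter] at hx
    rw [wtW_mul_wtW_eq, ← hx.2]
  rw [Finset.sum_congr rfl hc, ← Finset.mul_sum]
  refine mul_nonneg (wfib_nonneg F hp0 hp1 _ _) ?_
  -- the fibre sum is `#fp − #fm`
  have hsub : ∀ x ∈ fib, x.1 ⊆ F ∧ x.2 ⊆ F := by
    intro x hx
    rw [hfib, Finset.mem_filter, Finset.mem_product, Finset.mem_powerset, Finset.mem_powerset] at hx
    exact hx.1
  have hind : ∀ (k k' : ℕ), ∀ x ∈ fib,
      ind (pat (U ∩ Ms ∩ Lv k)) x.1 * ind (pat (Uᶜ ∩ Lv k')) x.2 =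
        if ((↑x.1 : Set ι) ∈ U ∧ (∃ f ∈ N, f ∉ x.1) ∧ #x.1 = k) ∧ ((↑x.2 : Set ι) ∉ U ∧ #x.2 = k') then (1 : ℝ) else 0 := by
    intro k k' x hx
    obtain ⟨h1, h2⟩ := hsub x hx
    have c1 : x.1 ∈ pat (U ∩ Ms ∩ Lv k) ↔ ((↑x.1 : Set ι) ∈ U ∧ (∃ f ∈ N, f ∉ x.1) ∧ #x.1 = k) := by
      simp only [mem_pat, Set.mem_inter_iff, hMs, hLv, Set.mem_setOf_eq, Finset.mem_coe, Finset.filter_mem_eq_inter,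
        Finset.inter_eq_right.2 h1, and_assoc]
    have c2 : x.2 ∈ pat (Uᶜ ∩ Lv k') ↔ ((↑x.2 : Set ι) ∉ U ∧ #x.2 = k') := by
      simp only [mem_pat, Set.mem_inter_iff, Set.mem_compl_iff, hLv, Set.mem_setOf_eq, Finset.mem_coe, Finset.filter_mem_eq_inter,
        Finset.inter_eq_right.2 h2]
    unfold ind
    rw [if_congr c1 rfl rfl, if_congr c2 rfl rfl]
    by_cases q1 : ((↑x.1 : Set ι) ∈ U ∧ (∃ f ∈ N, f ∉ x.1) ∧ #x.1 = k) <;>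
      by_cases q2 : ((↑x.2 : Set ι) ∉ U ∧ #x.2 = k') <;> simp [q1, q2]
  rw [Finset.sum_sub_distrib, Finset.sum_congr rfl (hind m m'), Finset.sum_congr rfl (hind m' m), Finset.sum_boole, Finset.sum_boole,
    sub_nonneg]
  obtain ⟨I, J⟩ := IJ
  exact_mod_cast fibre_card_filter_le F N I J hU hm

end Measure

end SahiOneStep

end Summit.CriticalPhenomena.PercolationContinuityZ3.Theorems
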